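import Literature.MathematicalPhysics.QuantumLattice.HubbardTTPrimeThermalPressureGrandCanonicalCeiling
import Literature.MathematicalPhysics.QuantumLattice.HubbardTTPrimeThermalPressureLimit
import Literature.MathematicalPhysics.QuantumLattice.HubbardAtomicLimit
import HarnessLib

/-!
# The ATOMIC CORNER of the canonical `t–t'` Hubbard pressure: `p(β; 0,0,U; n) ≤ log z₀(β,U,μ) − βμn`, and the
# DOUBLON-RESOLVED HOT ANCHOR `p(β; t,s,U; 1) ≤ 2λ log 2 − β·e(t,s,U′,1) + (1−λ)(log 2 + log(1 + e^{−β(U−U′)/(2(1−λ))}))`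

Topic `MathematicalPhysics/QuantumLattice` (family `hubbard`); written 2026-08-31 by `hubbard-downfold-unc-2` (g43, MO-S1 filling
lane of the Hubbard material oracle), the dense-partner twin of `HubbardTTPrimeFreeGCPressure` (g25: the FREE-gas ceiling of the
DILUTE partner's anchor).

WHY. Every hot-anchored `T > 0` competing-order word of the oracle (`HubbardTTPrimeThermalPhaseCoexistenceHotAnchor`,
`Summits/…/Observables/PhaseSeparationExclusionBox*Thermal*`) carries, for the DENSE partner density `n₂ = 1` of the excluded
mixture, the a-priori entropy cap `p(β_h = 0; 1) ≤ 2 log 2 = 1.386` (`pressureTT'_zero_le_two_mul_binEntropy`) — with weight `b ≥ 1/2`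
this is `0.69…0.9` of the numerator `K ≈ 1.0–1.1` of every threshold `β₀ = ⌈K/M⌉`. The free gas is useless as an anchor at half
filling and `U/t ≥ 5` (its energy sits `≈ 0.7·t` below the interacting column), but the CHARGE entropy is cheap to remove: at
`t = t' = 0` the model is classical and its pressure is EXPLICIT (`HubbardAtomicLimit.partitionFn_hamiltonianWith_zero_hopping`,
Ueltschi's `f₀(β,μ) = −β⁻¹ log[1 + 2e^{βμ} + e^{−βU+2βμ}]`), and the canonical pressure is JOINTLY CONVEX in the β-scaled couplings
`(βt, βt', βU)` on `{U ≥ 0}` (`pressureTT'_le_sum`). Splitting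
`β·(t, s, U) = λ·[(β/λ)·(t, s, U′)] + (1−λ)·[(β/(1−λ))·(0, 0, U−U′)]`, `0 ≤ U′ ≤ U`, `0 < λ < 1`,
into a COLD INTERACTING corner (a-priori window `p ≤ 2H_b(n/2) − (β/λ) e(t,s,U′,n)`) and a HOT ATOMIC corner gives

  `p(β; t,s,U; n) ≤ 2λ H_b(n/2) − β e(t,s,U′,n) + (1−λ) log z₀(β/(1−λ), U−U′, μ) − βμn`   (every real `μ`),

and at `n = 1`, `μ = (U−U′)/2`:  `p(β; t,s,U; 1) ≤ 2λ log 2 − β e(t,s,U′,1) + (1−λ)(log 2 + log(1 + e^{−β(U−U′)/(2(1−λ))}))`.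
As `λ → 0` and `β(U−U′) → ∞` the charge entropy `log 4 → log 2` is traded against `β·(e(U) − e(U′))` (`≈ β·ΔU·` double
occupancy): inside the hot-anchor law the dense bracket `b·(Q₂ + β_h L)` becomes `b·(A + β_h (L_U(s) − L_{U′}(s)))` with
`A ≈ log 2 + log(1 + e^{−β_hΔU/2})`, i.e. `≈ 1.15–1.2` instead of `1.386` at `U/t ≈ 5–8` with the tree's landed `n = 1`
columns at neighbouring `U′` (sized on landed words: `β₀ 59 → 54–56` on `[51/10, 21/4]`, `13 → 12` on `[71/10, 8]`;
`−20…25 %` on `K` at `U/t ≥ 10`).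

* §1 `log_partitionFn_atomicTT'_eq`: `log Re Tr e^{−β(H_L(0,0,U) − μN)} = L² log z₀(β,U,μ)` on EVERY torus, and the ceiling on
  the number `pressureTT'_atomic_le`: `p(β; 0,0,U; n) ≤ log z₀(β,U,μ) − βμn` (canonical ⇐ grand-canonical,
  `pressureTT'_add_le_of_grandCanonical_ceiling'`).
* §2 `pressureTT'_le_atomicCorner` (general `n`, `μ`, `λ`) and `pressureTT'_halfFilling_le_atomicCorner` (`n = 1`, `μ = ΔU/2`).
* §3 (private) kernel majorants `e^{−y} ≤ (1 + y/m)^{−m}`, `log(1 + e^{−y}) ≤ (1 + y/m)^{−m}`, `log 2 < 0.6931471808`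
  (Mathlib), so that consumers close the anchor constant with `norm_num` on a RATIONAL inequality; §4 the READER SHAPE of the hot-anchor law `atomicCorner_halfFilling_on_cell`:
  `∀ s ∈ [s₁,s₂], ∀ U ∈ [U₁,U₂], p(β_h; 1,s,U; 1) ≤ A − β_h·L′(s)` from a landed column `L′(s) ≤ e(1,s,U′,1)`, `0 ≤ U′ ≤ U₁`, and
  `2λ·c₂ + (1−λ)(c₂ + (1 + β_h(U₁−U′)/(2(1−λ)m))^{−m}) ≤ A` (`c₂ = 0.6931471808`; antitone in `U` first, then the corner bound at `U₁`).

Everything is PROVED (standard axioms); no definition, no named fact, no number of record. HONEST SCOPE: two convexity /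
monotonicity facts of the tree plus the classical atomic limit; the spin entropy `log 2` of the dense partner is NOT touched
(that needs a thermal certificate, cf. `HubbardTorusMarkovPressureBound`); not a phase word.

## Mathlib / tree search

REUSED: `pressureTT'_le_sum`, `pressureTT'_mem_Icc`, `pressureTT'_anti_U` (`HubbardTTPrimeThermalPressureLimit`);
`pressureTT'_add_le_of_grandCanonical_ceiling'` (`HubbardTTPrimeThermalPressureGrandCanonicalCeiling`);
`partitionFn_hamiltonianWith_zero_hopping_ofReal`, `atomicPartitionFnReal(_pos)` (`HubbardAtomicLimit`); `hubbardTorusTT'_zero`,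
`hubbardTorusWith_eq`; Mathlib `Real.add_one_le_exp`, `Real.log_le_sub_one_of_pos`, `Real.log_two_lt_d9`, `Real.binEntropy_two_inv`.
`lean search 'atomicPartitionFnReal'` in the thermal-pressure files / `'pressureTT._le_sum'` consumers: only `t'`-chords of hot caps
(`Certificates/HubbardSquare_n7o8_tpbox_thermal_hotCaps_convexC1tt`), no atomic corner (2026-08-31).

## References

* R. B. Israel, *Convexity in the Theory of Lattice Gases* (1979), Thm. I.2.4 (convexity of the pressure in the interaction).
  [cite: Israel1979, Thm. I.2.4]
* D. Ueltschi, J. Stat. Phys. 95 (1999) 693–717, §3 (the classical free energy `f₀(β,μ) = −β⁻¹ log[1 + 2e^{βμ} + e^{−βU+2βμ}]`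
  of the Hubbard model at `t = 0`). [cite: Ueltschi1999, §3]
* D. Ruelle, *Statistical Mechanics: Rigorous Results* (1969), §3.4 (canonical vs grand-canonical pressure). [cite: Ruelle1969, §3.4]
* E. H. Lieb, Commun. Math. Phys. 31 (1973) 327, §V (5.2)–(5.4) (concavity of the free energy in the coupling).
  [cite: Lieb1973, §V (5.2)–(5.4)]
-/

noncomputable section

namespace Literature.MathematicalPhysics.QuantumLattice

open Matrix Finset HubbardWave0
open _root_.Filter
open scoped _root_.Topology ComplexOrder BigOperators

namespace ThermodynamicLimit

/-! ### §1 The atomic limit on the torus and the ceiling on the number -/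

/-- The fermionic torus `(ℤ/Lℤ)²` has `L²` sites (re-derived; private copies exist in several files). [folklore] -/
private theorem card_fermionTorus_two_eq_sq (L : ℕ) : Fintype.card (FermionTorus 2 L) = L ^ 2 := by
  rw [Fintype.card_lex, Fintype.card_fun, Fintype.card_fin, Fintype.card_fin]

/-- **The atomic-limit grand-canonical partition function of the `t–t'` torus**: at `t = t' = 0`,
`log Re Tr e^{−β(H_L(0,0,U) − μN)} = L² · log z₀(β, U, μ)` with `z₀ = 1 + 2e^{βμ} + e^{−β(U−2μ)}`, on EVERY torus `L`
(the trace factorises over sites). [cite: Ueltschi1999, §3] -/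
theorem log_partitionFn_atomicTT'_eq (L : ℕ) (β U μ : ℝ) :
    Real.log (partitionFn β (hubbardTorusTT' L 0 0 U - (μ : ℂ) • totalNumber)).re =
      (L : ℝ) ^ 2 * Real.log (atomicPartitionFnReal β U μ) := by
  have hZ : partitionFn β (hubbardTorusTT' L 0 0 U - (μ : ℂ) • totalNumber) =
      ((atomicPartitionFnReal β U μ ^ Fintype.card (FermionTorus 2 L) : ℝ) : ℂ) := by
    -- (the instances on the torus chosen by `hubbardTorusWith` differ syntactically from the generic ones, whence `convert`)
    rw [hubbardTorusTT'_zero, ← hubbardTorusWith_eq]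
    unfold hubbardTorusWith
    convert partitionFn_hamiltonianWith_zero_hopping_ofReal (fermionTorusGraph 2 L) β U μ
  rw [hZ, Complex.ofReal_re, card_fermionTorus_two_eq_sq, Real.log_pow]
  push_cast
  ring

/-- **The ATOMIC CEILING on the number**: `p(β; 0, 0, U; n) ≤ log z₀(β, U, μ) − βμn` for every real `μ` (`β ≥ 0`, `U ≥ 0`,
`0 ≤ n < 2`) — the canonical sector pressure of the hopping-free model is below the Legendre bound from its explicit
grand-canonical pressure. [cite: Ueltschi1999, §3] [cite: Ruelle1969, §3.4] -/
theorem pressureTT'_atomic_le {β : ℝ} (hβ : 0 ≤ β) {U : ℝ} (hU : 0 ≤ U) {n : ℝ} (hn0 : 0 ≤ n) (hn2 : n < 2) (μ : ℝ) :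
    pressureTT' β 0 0 U n ≤ Real.log (atomicPartitionFnReal β U μ) - β * μ * n := by
  have hq : ∀ᶠ j : ℕ in atTop, Real.log (partitionFn β (hubbardTorusTT' (id j) 0 0 U - (μ : ℂ) • totalNumber)).re ≤
      Real.log (atomicPartitionFnReal β U μ) * ((id j : ℕ) : ℝ) ^ 2 :=
    Filter.Eventually.of_forall fun j => by rw [log_partitionFn_atomicTT'_eq, mul_comm]
  have h := pressureTT'_add_le_of_grandCanonical_ceiling' hβ 0 0 hU hn0 hn2 tendsto_id hq
  linarith

/-! ### §2 The atomic corner of the joint convexity: the doublon-resolved hot anchor -/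

/-- **THE ATOMIC CORNER (general filling)**: for `β ≥ 0`, `0 ≤ U′ ≤ U`, `0 ≤ n < 2`, `0 < λ < 1`, a `T = 0` floor
`F ≤ e(t, s, U′, n)` and every real `μ`,
`p(β; t,s,U; n) ≤ 2λ H_b(n/2) − β F + (1−λ) log z₀(β/(1−λ), U−U′, μ) − βμn`:
`β·(t,s,U) = λ·[(β/λ)(t,s,U′)] + (1−λ)·[(β/(1−λ))(0,0,U−U′)]`, joint convexity of the pressure in the β-scaled couplings
(`pressureTT'_le_sum`), the a-priori window at the cold interacting corner and the atomic ceiling at the hot corner.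
[cite: Israel1979, Thm. I.2.4] [cite: Ueltschi1999, §3] -/
theorem pressureTT'_le_atomicCorner {β : ℝ} (hβ : 0 ≤ β) (t s : ℝ) {U' U : ℝ} (hU' : 0 ≤ U') (hU'U : U' ≤ U)
    {n : ℝ} (hn0 : 0 ≤ n) (hn2 : n < 2) {lam : ℝ} (hl0 : 0 < lam) (hl1 : lam < 1)
    {F : ℝ} (hF : F ≤ energyDensityTT' t s U' n) (μ : ℝ) :
    pressureTT' β t s U n ≤ 2 * lam * Real.binEntropy (n / 2) - β * F +
      ((1 - lam) * Real.log (atomicPartitionFnReal (β / (1 - lam)) (U - U') μ) - β * μ * n) := by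
  have hl1' : 0 < 1 - lam := by linarith
  have hl0ne : lam ≠ 0 := hl0.ne'
  have hl1ne : (1 - lam) ≠ 0 := hl1'.ne'
  have hβ0 : 0 ≤ β / lam := div_nonneg hβ hl0.le
  have hβ1 : 0 ≤ β / (1 - lam) := div_nonneg hβ hl1'.le
  have hΔ : 0 ≤ U - U' := by linarith
  have hU : 0 ≤ U := hU'.trans hU'U
  have u0 : pressureTT' (β / lam) t s U' n ≤ 2 * Real.binEntropy (n / 2) - β / lam * F := by
    have h := (pressureTT'_mem_Icc hβ0 t s hU' hn0 hn2).2
    have : β / lam * F ≤ β / lam * energyDensityTT' t s U' n := mul_le_mul_of_nonneg_left hF hβ0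
    linarith
  have u1 : pressureTT' (β / (1 - lam)) 0 0 (U - U') n ≤
      Real.log (atomicPartitionFnReal (β / (1 - lam)) (U - U') μ) - β / (1 - lam) * μ * n :=
    pressureTT'_atomic_le hβ1 hΔ hn0 hn2 μ
  have h := pressureTT'_le_sum hn0 hn2 (Finset.univ : Finset (Fin 2)) ![lam, 1 - lam] ![β / lam, β / (1 - lam)]
    ![(t, s, U'), ((0 : ℝ), (0 : ℝ), U - U')]
    ![2 * Real.binEntropy (n / 2) - β / lam * F,
      Real.log (atomicPartitionFnReal (β / (1 - lam)) (U - U') μ) - β / (1 - lam) * μ * n]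
    (by intro k _; fin_cases k <;> simp <;> linarith) (by simp [Fin.sum_univ_two])
    (by intro k _; fin_cases k <;> simp <;> positivity) (by intro k _; fin_cases k <;> simp <;> linarith) hβ
    (q := (t, s, U)) (by simpa using hU)
    (by ext <;> (simp [Fin.sum_univ_two]; field_simp); ring)
    (by intro k _; fin_cases k
        · simpa using u0
        · simpa using u1)
  have h2 := h
  simp only [Fin.sum_univ_two, Matrix.cons_val_zero, Matrix.cons_val_one] at h2
  refine h2.trans (le_of_eq ?_)
  field_simp
  try ring

/-- **THE DOUBLON-RESOLVED HOT ANCHOR AT HALF FILLING** (`n = 1`, `μ = (U−U′)/2`): for `β ≥ 0`, `0 ≤ U′ ≤ U`, `0 < λ < 1`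
and a `T = 0` floor `F ≤ e(t, s, U′, 1)`,
`p(β; t,s,U; 1) ≤ 2λ log 2 − β F + (1−λ)(log 2 + log(1 + e^{−β(U−U′)/(2(1−λ))}))`
— the charge entropy `log 4` of the a-priori anchor is resolved into the spin entropy `log 2` plus the Boltzmann-suppressed
doublon term, at the price `β·(e(U) − F)` paid inside the consumer's law. [cite: Israel1979, Thm. I.2.4] [cite: Ueltschi1999, §3] -/
theorem pressureTT'_halfFilling_le_atomicCorner {β : ℝ} (hβ : 0 ≤ β) (t s : ℝ) {U' U : ℝ} (hU' : 0 ≤ U')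
    (hU'U : U' ≤ U) {lam : ℝ} (hl0 : 0 < lam) (hl1 : lam < 1) {F : ℝ} (hF : F ≤ energyDensityTT' t s U' 1) :
    pressureTT' β t s U 1 ≤ 2 * lam * Real.log 2 - β * F +
      (1 - lam) * (Real.log 2 + Real.log (1 + Real.exp (-(β * (U - U') / (2 * (1 - lam)))))) := by
  have hl1' : 0 < 1 - lam := by linarith
  have hl1ne : (1 - lam) ≠ 0 := hl1'.ne'
  have h := pressureTT'_le_atomicCorner hβ t s hU' hU'U zero_le_one one_lt_two hl0 hl1 hF ((U - U') / 2)
  have hH : Real.binEntropy ((1 : ℝ) / 2) = Real.log 2 := by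
    rw [one_div]; exact Real.binEntropy_two_inv
  set x : ℝ := β / (1 - lam) * ((U - U') / 2) with hx
  have hxe : -(β * (U - U') / (2 * (1 - lam))) = -x := by
    rw [hx]; field_simp
  have hz : Real.log (atomicPartitionFnReal (β / (1 - lam)) (U - U') ((U - U') / 2)) =
      Real.log 2 + x + Real.log (1 + Real.exp (-(β * (U - U') / (2 * (1 - lam))))) := by
    unfold atomicPartitionFnReal
    have e2 : -(β / (1 - lam) * (U - U' - 2 * ((U - U') / 2))) = 0 := by ring
    rw [e2, Real.exp_zero, hxe]
    have e3 : (1 : ℝ) + 2 * Real.exp (β / (1 - lam) * ((U - U') / 2)) + 1 =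
        2 * (Real.exp x * (1 + Real.exp (-x))) := by
      rw [← hx, mul_add, mul_one, ← Real.exp_add, add_neg_cancel, Real.exp_zero]; ring
    rw [e3, Real.log_mul (by norm_num) (by positivity), Real.log_mul (by positivity) (by positivity), Real.log_exp]
    ring
  rw [hz, hH] at h
  refine h.trans (le_of_eq ?_)
  rw [hx]
  field_simp
  try ring

/-! ### §3 Kernel majorants: the anchor constant is closed by `norm_num` on a rational inequality -/

/-- `e^{−y} ≤ (1 + y/m)^{−m}` for `y ≥ 0`, `m ≥ 1` (`1 + y/m ≤ e^{y/m}`). [folklore] -/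
private theorem exp_neg_le_inv_one_add_div_pow {y : ℝ} (hy : 0 ≤ y) {m : ℕ} (hm : 1 ≤ m) :
    Real.exp (-y) ≤ 1 / (1 + y / m) ^ m := by
  have hm0 : (0 : ℝ) < m := by exact_mod_cast hm
  have hbase : 0 < 1 + y / m := by positivity
  have h1 : (1 + y / m) ^ m ≤ Real.exp y := by
    have hstep : 1 + y / m ≤ Real.exp (y / m) := by
      have := Real.add_one_le_exp (y / m); linarith
    calc (1 + y / m) ^ m ≤ (Real.exp (y / m)) ^ m := pow_le_pow_left₀ hbase.le hstep m
      _ = Real.exp y := by rw [← Real.exp_nat_mul]; congr 1; field_simp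
  rw [Real.exp_neg, one_div]
  exact inv_anti₀ (pow_pos hbase m) h1

/-- `log(1 + e^{−y}) ≤ (1 + y/m)^{−m}` for `y ≥ 0`, `m ≥ 1` (`log(1 + r) ≤ r`). [folklore] -/
private theorem log_one_add_exp_neg_le {y : ℝ} (hy : 0 ≤ y) {m : ℕ} (hm : 1 ≤ m) :
    Real.log (1 + Real.exp (-y)) ≤ 1 / (1 + y / m) ^ m := by
  have h0 : 0 < 1 + Real.exp (-y) := by positivity
  have h1 : Real.log (1 + Real.exp (-y)) ≤ Real.exp (-y) := by
    have := Real.log_le_sub_one_of_pos h0; linarith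
  exact h1.trans (exp_neg_le_inv_one_add_div_pow hy hm)

/-- **The rational majorant of the anchor constant**: for `0 ≤ λ ≤ 1`, `y ≥ 0`, `m ≥ 1`,
`2λ log 2 + (1−λ)(log 2 + log(1 + e^{−y})) ≤ 2λ c₂ + (1−λ)(c₂ + (1 + y/m)^{−m})`, `c₂ = 0.6931471808`
(`Real.log_two_lt_d9`). [folklore] -/
private theorem atomicCornerConst_le {lam y : ℝ} (hl0 : 0 ≤ lam) (hl1 : lam ≤ 1) (hy : 0 ≤ y) {m : ℕ} (hm : 1 ≤ m) :
    2 * lam * Real.log 2 + (1 - lam) * (Real.log 2 + Real.log (1 + Real.exp (-y))) ≤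
      2 * lam * (6931471808 / 10 ^ 10) + (1 - lam) * (6931471808 / 10 ^ 10 + 1 / (1 + y / m) ^ m) := by
  have hL : Real.log 2 ≤ 6931471808 / 10 ^ 10 := by
    have := Real.log_two_lt_d9; norm_num at this ⊢; linarith
  have hE := log_one_add_exp_neg_le hy hm
  have h1l : 0 ≤ 1 - lam := by linarith
  have k1 := mul_le_mul_of_nonneg_left hL (by positivity : (0 : ℝ) ≤ 2 * lam)
  have k2 := mul_le_mul_of_nonneg_left (add_le_add hL hE) h1l
  linarith

/-! ### §4 The reader shape of the hot-anchor law (`n₂ = 1`) -/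

/-- **THE DOUBLON-RESOLVED DENSE ANCHOR ON A CELL** (the `hπ₂` hypothesis shape of
`psT_not_thermal_mix_on_cell_of_columns_hotAnchorSS_tcap` and its field / grand-canonical twins, `t = 1`, `n₂ = 1`):
a landed `n = 1` column `L′(s) ≤ e(1, s, U′, 1)` on `[s₁, s₂]` at some `0 ≤ U′ ≤ U₁`, a hot inverse temperature `β_h ≥ 0`,
`0 < λ < 1`, `m ≥ 1` and a rational `A` with `2λ c₂ + (1−λ)(c₂ + (1 + β_h(U₁−U′)/(2(1−λ)m))^{−m}) ≤ A` give
`p(β_h; 1, s, U; 1) ≤ A − β_h·L′(s)` for every `s ∈ [s₁, s₂]`, `U ∈ [U₁, U₂]` (antitone in `U`, then the atomic corner at `U₁`).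
In the law the dense bracket `b·(Q₂(s) + β_h L(s))` reads `b·(A + β_h (L(s) − L′(s)))` instead of `b·2 log 2`.
[cite: Israel1979, Thm. I.2.4] [cite: Ueltschi1999, §3] -/
theorem atomicCorner_halfFilling_on_cell {s₁ s₂ U₁ U₂ U' βh lam A : ℝ} {m : ℕ} {Lp : ℝ → ℝ}
    (hU' : 0 ≤ U') (hU'U : U' ≤ U₁) (hβh : 0 ≤ βh) (hl0 : 0 < lam) (hl1 : lam < 1) (hm : 1 ≤ m)
    (hL : ∀ s ∈ Set.Icc s₁ s₂, Lp s ≤ energyDensityTT' 1 s U' 1)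
    (hA : 2 * lam * (6931471808 / 10 ^ 10) +
        (1 - lam) * (6931471808 / 10 ^ 10 + 1 / (1 + βh * (U₁ - U') / (2 * (1 - lam)) / m) ^ m) ≤ A) :
    ∀ s ∈ Set.Icc s₁ s₂, ∀ U ∈ Set.Icc U₁ U₂, pressureTT' βh 1 s U 1 ≤ A - βh * Lp s := by
  intro s hs U hU
  have hU₁ : 0 ≤ U₁ := hU'.trans hU'U
  have h1 : pressureTT' βh 1 s U 1 ≤ pressureTT' βh 1 s U₁ 1 :=
    pressureTT'_anti_U zero_le_one one_lt_two hβh 1 s hU₁ hU.1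
  have h2 := pressureTT'_halfFilling_le_atomicCorner hβh 1 s hU' hU'U hl0 hl1 (hL s hs)
  have hy : 0 ≤ βh * (U₁ - U') / (2 * (1 - lam)) :=
    div_nonneg (mul_nonneg hβh (by linarith)) (by linarith)
  have h3 := atomicCornerConst_le hl0.le hl1.le hy hm
  linarith

end ThermodynamicLimit

end Literature.MathematicalPhysics.QuantumLattice
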